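import Summits.NavierStokesRegularity.NavierStokesRegularity.Theorems.PalasekTowerBreakdownEpisodeBaseTMechanismFreeRun
import Literature.Analysis.FluidPDE.AxisymmetricEuler
import Literature.Analysis.FluidPDE.Hou2022InitialData

/-!
# Line `hou_tornado` for the crux `PalasekTowerBreakdown.EpisodeBaseT` (stmt-20303) — an UNSTEADY, SELF-DRIVEN member of the
# free-run door: Hou's 2021 axisymmetric swirl datum («tornado» collapse) transplanted to ℝ³ at the tuned rates; plus rung 2:
# the same closer at HIGH-REYNOLDS rates `hiRe` (kernel-checked).

Seat ns-idea-12 g3 (D-0145 ideator, lens «oqh» = open-question harvest). FILES ONLY (KEY-NS #87/#93): nothing registered;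
no summit, no crux and no Navier–Stokes statement is proved by this file. `sorry` occurs exactly in the four `stub_*` theorems.

## Why this line (after M1 «FACES-MISSED-DNS» and the passenger wall `Lines/passenger_wall.md`)
`passenger_wall.md` (this seat, today) shows by two exact identities (ψ-return of processed fluid; Bernoulli along steady
host-frame streamlines) that every QUASI-STEADY member — a passenger structure amplified in a coherent host's strain or by
geometric swirl focusing — misses the tuned speed face `Y₁ = 2.07 Y₀`, and that any member must realise a coherent material
stretch `λ ≥ 6.4` (7–9 at `ν = 1`) inside the last `0.4 w₀`; head-on ring pairs give `λ ≈ 3–4` (R19: 0.55 of the face). The one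
printed smooth, finite-energy, axisymmetric Navier–Stokes computation that produces LARGE growth of BOTH `‖u‖_∞` and `‖∇u‖_∞`
from rest-like data at moderate Reynolds number is Hou's interior «tornado» [corpus:paper:arxiv-2107.06509 = Hou, FoCM 2022]:
datum `u₁(0,r,z) = 12000 (1−r²)^18 sin(2πz)/(1 + 12.5 sin²(πz))`, `ω₁ = ψ₁ = 0` — «the flow is completely driven by large swirl
initially» (p6 L35–39); `‖ω‖_∞` grows by `10⁴ … 10⁷` (p8 L21, p12 L46), `‖u‖_∞ ∼ (T−t)^{−1/2}`, `Z(t) ∼ (T−t)^{1/2}` (p11 L41–47);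
viscosity `5·10⁻⁴` to `t₀`, then `5·10⁻³` (p10 L19); «if the viscosity is too large, it would destroy the mechanism» (p7 L6).
It is NOT a passenger (self-driven: the `z`-modulated swirl pumps its own poloidal flow, which carries angular momentum to the
axis — genuinely unsteady, outside the Bernoulli cap), NOT sterile (swirl is the engine; the tree's no-swirl no-heredity lemma
does not fire), NOT a reconnection relay (`FluidComputer/ColliderRelay.lean` does not apply), and 2-D `(r, z)` computable.

## The member (§1) and the desk transplant (units: length 1/N₀, speed N₀, time 1/N₀², rate N₀² = A₀/776)
Potential `potH p x = cutoff(x) · G(ϖ², x₂) · e₃`, `G(q, ζ) = (SΛ²/36) e^{−18q/Λ²} g(ζ) e^{−ζ²/2σ_z²}`, `g(ζ) = sin(2πζ/Λ)/(1 + (25/2)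
sin²(πζ/Λ))`; since `curl (G e₃) = −2 ∂_qG · (−x₁, x₀, 0)`, the datum `W = curl (potH p)` is the PURE SWIRL `u_θ = S ϖ e^{−18ϖ²/Λ²}
g(z) e^{−z²/2σ_z²}` (Hou's `r u₁` with `(1−r²)^18 ↦ e^{−18r²}`, the same to 3 % where it matters, an axial Gaussian envelope over
±1.5 periods instead of the periodic cylinder, NO wall at `r = Λ`; the cut-off only acts where `G ≤ e^{−4.5}` of its maximum).
Hou's numbers: `g_max = 0.272` at `z = 0.085`, peak swirl speed `u_H = 328` at `r = 0.164`, `T_H = 2.2868·10⁻³ = 3.2` turnovers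
`ℓ/u_H` of the swirl-core radius `ℓ = 0.236`. DESIGN DIAL `s` = datum peak speed / `Y₀`; reading Hou's late law from `t = 1` with
the datum's prefactors (a PLACEHOLDER the decider calibrates — Hou's `max u₁` first decreases, p6 L48), the speed face at `τ₁` with
the mid-window value `2.8 Y₀ ∈ [1.1·Y₁, (5/3)Y₁) = [2.28, 3.45] Y₀` needs `(T − τ₁)/T = (s/2.8)²`, `T = w₀/(1 − (s/2.8)²)`:
  s = 0.50: T = 1.033 w₀, Λ = 116/N₀ (ℓ = 27/N₀), σ_z = 175/N₀, ρ₀ = 750/N₀, S = (5/32)A₀; Re_ℓ = sY₀ℓ = 1.06·10⁴;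
            Hou-equivalent viscosity ν_H = 7.3·10⁻³ (= 1.5 × his late ν, 15 × his early ν); gradient at t = 1:
            ∂_z u_θ ≈ 0.10 A₀ (∂_r: 0.043 A₀) ⇒ ×31.4 at τ₁ = 3.1 A₀ vs A₁ = 3.48 A₀ (needs the transition to raise
            ‖∇u‖/‖u‖² by q ≥ 1.12); loop (least critical): an axis-centred circle of radius 1/N₁ = 0.595/N₀ at height Z(τ₁) wound
            4 times (|γ′| = 8π/N₁ exactly) carries 8π·Γ̃(0.595, Z), Γ̃ = ϖu_θ, so it needs Γ̃ ≥ 955/8π = 38 (datum: 11.7 there,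
            sup Γ̃ = SΛ²g_max/18e = 9.1·10³ ⇒ the `‖ϖu_θ‖_∞` maximum principle is no obstruction; self-similar collapse of the
            peak radius Λ/6 = 19 ↦ 3.5 gives Γ̃(0.595) ≈ 2.2·10²); cap: monotone growth ⇒ sup = 2.8 Y₀ < 3.45 Y₀ (+23 %; floor −19 %).
  s = 0.60: T = 1.048 w₀, Λ = 141, Re_ℓ = 1.6·10⁴, ν_H = 5.0·10⁻³ (= Hou's late ν), gradient needs q ≥ 1.6.
  s = 0.83: Λ = 205, Re_ℓ = 3.1·10⁴, ν_H = 2.5·10⁻³, gradient needs q ≥ 3.3 (speed-rich, gradient-poor).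
`pStar` below is the `s = 0.50` point. Why the squeeze: Hou's short fuse (3.2 turnovers) must fill `≈ w₀`, forcing a LARGE slow
host (Λ ≈ 116/N₀), whose datum gradient is only `0.1 A₀`; the Type-I law `‖∇u‖ ∝ ‖u‖²` then lands the gradient face within 12 %.

## Stubs (2 static · 2 dynamic) and the decider
A `DatumStaticH` (M, provable calculus) · A′ `AnchorH` (M: `sup ‖W‖ = 0.5 Y₀ (1 + O(e^{−4.5}))`) · B0 `SmoothRunH` (the free run from
`W` stays classical with bounded energy on `[1, τ₁]` — axisymmetric WITH swirl: no theorem gives it; kernel = W12-class certificate of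
one 2-D run; carries no stage) · B `FacesH` (every such run obeys the cap and shows the three tuned faces inside `‖x‖ ≤ ρ₀` at `τ₁`).
DECIDER / CHEAPEST FALSIFIER S0 (kill-first, ≈ 1 core-h, any axisymmetric `(u₁, ω₁, ψ₁)` solver; PRE-REGISTERED words in
`Lines/hou_tornado_prereg.md`): Hou's EXACT problem BY NAME — datum `Hou2022.initialU1` (= swirl of `Hou2022.initialVelocity`,
`Literature/Analysis/FluidPDE/Hou2022InitialData.lean`) on his periodic no-slip cylinder with (2.3)–(2.6) — at the CONSTANT viscosity
`S0nu pStar = 12000/(SΛ²) = (4800/841)N₀²/A₀ = 7.35·10⁻³ = 1.47·Hou2022.nuLate` (`S0nu_pStar`; Reynolds-equivalent to our `ν = 1` run) from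
`t = 0` on `[0, 1.1 T_H]`, uniform `1024 × 512`: words ONSET (`‖u‖_∞(t)/‖u‖_∞(0) ≥ 2.3` and `‖∇u‖_∞` growth ≥ ×20 at some `t ≤ 1.1 T_H`) /
NO-ONSET, with the gain `q(t) = (‖∇u‖_∞/‖u‖²_∞)(t)/(‖∇u‖_∞/‖u‖²_∞)(0)` PRINTED along the run (the s-dial cannot be tuned after the fact).
KILL-FIRST ONLY: NO-ONSET on the cylinder kills the ℝ³ member AT THE TUNED RATES a fortiori (the wall helps Hou) and is the predicted reading
of p7 L6; ONSET there does NOT transfer (then S1 in ℝ³ decides); neither touches rung 2. Instrument row that refutes B: S0 = NO-ONSET, or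
ONSET with `q < 1.12` at every `s ∈ [0.45, 0.65]` (gradient face unreachable before the cap). CENSUS WORDING (BC4): the DATUM and the
SCHEDULE are known-in-tree (`Hou2022.initialU1/initialVelocity/nuEarly/nuLate/tSwitch`, comparand lemma `gH_eq_initialU1_axis`); the ℝ³
TRANSPLANT + free-run door + the S0 question at the tuned Reynolds number are the line's own.

## Rung 2 (§R, kernel-checked, no stub): the same closer at HIGH-REYNOLDS rates
`TowerRates` has no upper constraint on `N₀`. `hiRe := (2^40, 163/160, 12/5, 49/20)` has `(b−1)·log₂N₀ = 3/4` EXACTLY as `tuned`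
(`hiRe_same_step`), hence the SAME per-level face ratios `Y₁/Y₀ = 2^{1.05}`, `A₁/A₀ = 2^{1.8}`, `N₀/N₁ = 2^{−3/4}`, a window of
`4bβ ln N₁ = 276` strain times (tuned: 170), and `Re₀ = N₀^{β−2} = 2^16 = 65 536` (tuned: 776): since `Re_ℓ = s²·1.033·(4bβ ln N₁)·
Re₀/3.2`, the `s = 0.5` transplant then runs at `Re_ℓ ≈ 1.5·10⁶`, Hou-equivalent viscosity `≈ 5·10⁻⁵` — ten times deeper than his early
regime (`Re_ℓ = 1.5·10⁵`, `ν = 5·10⁻⁴`). `breakdownR3_of_hiRe` is the route's `closes` shape at `hiRe` (`navierStokesBreakdownR3_of_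
heredityGAt`, generic in `R`); `hiRe` satisfies every `TowerRates` constraint (kernel-checked). What rung 2 costs: a free-run door at
general `R` (the landed door is tuned-only) and the three items at `hiRe` — a tenure decision, recorded here as the typed alternative the
Reynolds squeeze (`Lines/passenger_wall.md` §3) points to.

## Why it might fail (numbered for the critic)
R1 viscosity threshold (p7 L6): the early transition may need `ν_H ≲ 10⁻³`; at tuned we sit at `7.3·10⁻³` — S0 decides (predicted
NO-ONSET ⇒ member dead at tuned, alive at `hiRe`). R2 gradient face: needs `q ≥ 1.12` (s = 0.5). R3 the law's prefactor from `t = 1`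
is a placeholder (early decrease of `max u₁`, p6 L48): the dial `s ↔ T` is calibrated by S0's growth curve, window `s ∈ [0.45, 0.65]`.
R4 no wall: Hou's no-slip wall at `r = 1` (↦ `Λ`) is replaced by decay + cut-off at `6.4Λ`; «u₁ decays rapidly as r approaches the
boundary» (p6 L44) and the action is at `r ≤ 0.3`, but the poloidal return flow differs (moderate). R5 certificate: B0/B as kernel
objects are W12-infeasible at present means (as every free-run member); the line is a DESIGN line with a cheap decider, bears_on N1.
-/

noncomputable section

set_option linter.dupNamespace false

namespace Summit.NavierStokesRegularity.NavierStokesRegularity.Cruxes.EpisodeBaseT.HouTornado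

open Set MeasureTheory Filter Topology Function Metric
open scoped ENNReal ContDiff NNReal
open Literature.Analysis.FluidPDE
open Summit.NavierStokesRegularity.FluidComputer
open Summit.NavierStokesRegularity.FluidComputer.PalasekTowerClayBridge
open Summit.NavierStokesRegularity.NavierStokesRegularity.Theses

/-! ## §0 Tuned numbers (abbreviations only) -/

/-- Base frequency `N₀(tuned) = 2^24`. -/
abbrev N0 : ℝ := TowerRates.tuned.N 0

/-- Datum speed bound `Y₀(tuned) = N₀^{7/5}`. -/
abbrev Y0 : ℝ := TowerRates.tuned.Y 0

/-- Base rate `A₀(tuned) = N₀^{12/5}`. -/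
abbrev A0 : ℝ := TowerRates.tuned.A 0

/-- End of the first window `τ₁ = 1 + w₀`. -/
abbrev τ1 : ℝ := Host.τfirstAt TowerRates.tuned

/-! ## §1 The explicit datum class: cut-off potential of Hou's modulated swirl — time `t = 1` only -/

/-- Static data of the transplanted Hou datum: swirl-rate amplitude `S` (Hou's `12000`), length unit `Λ` (Hou's cylinder radius
and axial period), axial envelope width `σz`, cut-off radius `ρ₀`. Nothing is prescribed after `t = 1`. -/
structure HouDatum where
  S : ℝ
  Λ : ℝ
  σz : ℝ
  ρ₀ : ℝ

/-- Squared distance to the symmetry (`x₂`-)axis, `ϖ² = y₀² + y₁²`. -/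
def cylSq (y : EuclideanSpace ℝ (Fin 3)) : ℝ := y 0 ^ 2 + y 1 ^ 2

/-- The axial unit vector `e₃`. -/
def e3 : EuclideanSpace ℝ (Fin 3) := EuclideanSpace.single 2 (1 : ℝ)

/-- Hou's axial profile `g(ζ) = sin(2πζ/Λ) / (1 + (25/2) sin²(πζ/Λ))` (odd, period `Λ`, biased toward `ζ = 0`; p6 L35–44). -/
def gH (p : HouDatum) (ζ : ℝ) : ℝ :=
  Real.sin (2 * Real.pi * ζ / p.Λ) / (1 + 25 / 2 * Real.sin (Real.pi * ζ / p.Λ) ^ 2)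

/-- The scalar potential `G(q, ζ) = (SΛ²/36) e^{−18q/Λ²} g(ζ) e^{−ζ²/(2σz²)}`; `−2 ∂_q G = S e^{−18q/Λ²} g(ζ) e^{−ζ²/(2σz²)}` is the
swirl rate `u₁ = u_θ/ϖ` of the datum. -/
def GH (p : HouDatum) (q ζ : ℝ) : ℝ :=
  p.S * p.Λ ^ 2 / 36 * Real.exp (-18 * q / p.Λ ^ 2) * gH p ζ * Real.exp (-ζ ^ 2 / (2 * p.σz ^ 2))

/-- Radial smooth cut-off: `= 1` for `‖x‖ ≤ ρ₀/√2`, `= 0` for `‖x‖ ≥ ρ₀`. -/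
def cutoff (p : HouDatum) (x : EuclideanSpace ℝ (Fin 3)) : ℝ :=
  Real.smoothTransition (2 - 2 * ‖x‖ ^ 2 / p.ρ₀ ^ 2)

/-- THE EXPLICIT COMPACTLY SUPPORTED POTENTIAL: `cutoff · G(ϖ², x₂) · e₃`; its curl is the pure-swirl datum. -/
def potH (p : HouDatum) (x : EuclideanSpace ℝ (Fin 3)) : EuclideanSpace ℝ (Fin 3) :=
  (cutoff p x * GH p (cylSq x) (x 2)) • e3

/-- THE REGIME: positive scales, nondegenerate amplitude, cut-off far outside the envelope (`6Λ ≤ ρ₀`, `σz ≤ 2Λ`). -/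
def RegimeH (p : HouDatum) : Prop :=
  0 < p.Λ ∧ 0 < p.σz ∧ 0 < p.ρ₀ ∧ p.S ≠ 0 ∧ 6 * p.Λ ≤ p.ρ₀ ∧ p.σz ≤ 2 * p.Λ

/-- THE DESIGN POINT `s = 0.50` (module docstring): `S = (5/32)A₀`, `Λ = 116/N₀`, `σz = 175/N₀`, `ρ₀ = 750/N₀`. -/
def pStar : HouDatum where
  S := 5 / 32 * A0
  Λ := 116 / N0
  σz := 175 / N0
  ρ₀ := 750 / N0

/-- **S0's viscosity, BY NAME over the tree's typing of Hou's problem (BC4; idea-crit-7 P1).** S0 runs Hou's EXACT problem — datum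
`Hou2022.initialU1` (= the swirl of `Hou2022.initialVelocity`, `Literature/Analysis/FluidPDE/Hou2022InitialData.lean`) on his periodic no-slip
cylinder with the pole / wall conditions (2.3)–(2.6) — at the CONSTANT viscosity that makes it Reynolds-equivalent to our `ν = 1` run from
`curl (potH p)`: velocity ratio `12000/(SΛ)`, length ratio `1/Λ`, hence `ν_S0(p) = 12000/(S Λ²)`; at `pStar`: `(4800/841)·N₀²/A₀ = 5.707/776 =
7.35·10⁻³ = 1.47·Hou2022.nuLate = 14.7·Hou2022.nuEarly` (`S0nu_pStar`). KILL-FIRST semantics only (P4): NO-ONSET on the cylinder kills the ℝ³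
transplant a fortiori (the wall helps Hou); ONSET there does NOT transfer — then S1 (ℝ³) decides. [cite: Hou2022PotentiallySingularNS, §2–§3] -/
def S0nu (p : HouDatum) : ℝ := 12000 / (p.S * p.Λ ^ 2)

/-! ## §1b Proved static facts (no sorry) -/

/-- **By-name comparand (BC4; idea-crit-7 P1):** the axial profile `g` IS Hou's printed `u₁(0, 0, ·)/12000` read at period `Λ`:
`gH p ζ = Hou2022.initialU1 0 (ζ/Λ) / 12000`. The transplant replaces only the radial factor `(1 − r²)^18` of `Hou2022.initialU1` by `e^{−18r²}`
(within 1 % at the swirl peak `r = 0.164`, 3 % for `r ≤ 0.24`, 7 % at `r = 0.3`) and adds the axial Gaussian envelope and the cut-off (compact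
support in ℝ³ instead of the periodic no-slip cylinder). [cite: Hou2022PotentiallySingularNS, §2 eq. (2.2)] -/
theorem gH_eq_initialU1_axis (p : HouDatum) (ζ : ℝ) : gH p ζ = Hou2022.initialU1 0 (ζ / p.Λ) / 12000 := by
  have h1 : 2 * Real.pi * (ζ / p.Λ) = 2 * Real.pi * ζ / p.Λ := by ring
  have h2 : Real.pi * (ζ / p.Λ) = Real.pi * ζ / p.Λ := by ring
  have hd : (1 + 25 / 2 * Real.sin (Real.pi * ζ / p.Λ) ^ 2) ≠ 0 := by positivity
  simp only [gH, Hou2022.initialU1, h1, h2]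
  field_simp
  ring


theorem N0_pos : 0 < N0 := TowerRates.tuned.N_pos 0

theorem Y0_pos : 0 < Y0 := Real.rpow_pos_of_pos (TowerRates.tuned.N_pos 0) _

theorem A0_pos : 0 < A0 := TowerRates.tuned.A_pos 0

/-- `ν_S0(pStar) = (4800/841)·N₀²/A₀` (`= 7.35·10⁻³` since `A₀/N₀² = N₀^{β−2} = 2^{9.6} = 776`). -/
theorem S0nu_pStar : S0nu pStar = 4800 / 841 * (N0 ^ 2 / A0) := by
  have hN := N0_pos
  have hA := A0_pos
  simp only [S0nu, pStar]
  field_simp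
  ring


/-- The design point lies in the regime. -/
theorem regime_pStar : RegimeH pStar := by
  have hN := N0_pos
  have hA := A0_pos
  refine ⟨?_, ?_, ?_, ?_, ?_, ?_⟩
  · show 0 < 116 / N0; positivity
  · show 0 < 175 / N0; positivity
  · show 0 < 750 / N0; positivity
  · show 5 / 32 * A0 ≠ 0; positivity
  · show 6 * (116 / N0) ≤ 750 / N0
    rw [show 6 * (116 / N0) = 696 / N0 by ring]
    exact div_le_div_of_nonneg_right (by norm_num) hN.le
  · show 175 / N0 ≤ 2 * (116 / N0)
    rw [show 2 * (116 / N0) = 232 / N0 by ring]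
    exact div_le_div_of_nonneg_right (by norm_num) hN.le

/-- The cut-off is smooth. -/
theorem cutoff_contDiff (p : HouDatum) : ContDiff ℝ ∞ (cutoff p) := by
  have h : ContDiff ℝ ∞ (fun x : EuclideanSpace ℝ (Fin 3) => 2 - 2 * ‖x‖ ^ 2 / p.ρ₀ ^ 2) :=
    contDiff_const.sub ((contDiff_const.mul (contDiff_norm_sq ℝ)).div_const _)
  exact Real.smoothTransition.contDiff.comp h

/-- The cut-off vanishes outside the ball of radius `ρ₀` (for `ρ₀ > 0`). -/
theorem cutoff_eq_zero_of_le (p : HouDatum) (hρ : 0 < p.ρ₀) {x : EuclideanSpace ℝ (Fin 3)} (hx : p.ρ₀ ≤ ‖x‖) :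
    cutoff p x = 0 := by
  unfold cutoff
  apply Real.smoothTransition.zero_of_nonpos
  have hx2 : p.ρ₀ ^ 2 ≤ ‖x‖ ^ 2 := pow_le_pow_left₀ hρ.le hx 2
  have hρ2 : 0 < p.ρ₀ ^ 2 := by positivity
  rw [sub_nonpos, le_div_iff₀ hρ2]
  linarith

/-- **Support clause of stub A, proved:** `tsupport (potH p) ⊆ B̄(0, ρ₀)` whenever `ρ₀ > 0`. -/
theorem potH_tsupport_subset (p : HouDatum) (hρ : 0 < p.ρ₀) :
    tsupport (potH p) ⊆ closedBall (0 : EuclideanSpace ℝ (Fin 3)) p.ρ₀ := by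
  refine closure_minimal (fun x hx => ?_) isClosed_closedBall
  rw [mem_closedBall, dist_zero_right]
  by_contra h
  push Not at h
  apply hx
  show potH p x = 0
  simp only [potH, cutoff_eq_zero_of_le p hρ h.le, zero_mul, zero_smul]

/-! ## §2 The four stubs (typed), and the composition concluding the crux BY NAME -/

/-- **STUB A — STATIC DATUM LEMMA (calculus, M; provable: `exp`, `sin`, division by `1 + (25/2) sin² > 0`, `smoothTransition`;
rotation-equivariance; the swirl of `curl (G e₃) = −2∂_qG · (−x₁, x₀, 0)` is `−2ϖ² ∂_qG ≠ 0` off the nodes).** For every datum of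
the regime, `potH p` is `C^∞` with `tsupport ⊆ B̄(0, ρ₀)` and `curl (potH p)` is axisymmetric WITH swirl. Why it might fail: only
by a typing slip (orientation of `curl` flips the sign of `u_θ`, immaterial). -/
def DatumStaticH : Prop :=
  ∀ p : HouDatum, RegimeH p →
    ContDiff ℝ ∞ (potH p) ∧ tsupport (potH p) ⊆ closedBall 0 p.ρ₀ ∧
    IsAxisymmetric (curl (potH p)) ∧ ¬ HasNoSwirl (curl (potH p))

/-- **STUB A′ — ANCHOR AT THE DESIGN POINT (real inequalities, M).** `‖curl (potH pStar) x‖ < Y₀` for every `x` (desk: peak swirl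
speed `S (Λ/6) e^{−1/2} g_max = 0.50 Y₀`; cut-off term `≤ e^{−4.5}` of it). Why it might fail: a mis-placed constant (margin 2×). -/
def AnchorH : Prop :=
  ∀ x, ‖curl (potH pStar) x‖ < Y0

/-- **STUB B0 — THE FREE RUN STAYS CLASSICAL (regularity of ONE axisymmetric-with-swirl run on `[1, τ₁]`, finite energy; L as a
statement, XL/W12 as a kernel certificate; carries no stage).** Why it might fail: it does not at these amplitudes (`Re_ℓ ≈ 10⁴`,
one window) — but no theorem gives it (axisymmetric WITH swirl), so it is a stub, not a lemma. -/
def SmoothRunH : Prop :=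
  ∃ (v : ℝ → EuclideanSpace ℝ (Fin 3) → EuclideanSpace ℝ (Fin 3)) (q : ℝ → EuclideanSpace ℝ (Fin 3) → ℝ),
    IsClassicalNSSolutionOn (Icc 1 τ1) 1 0 v q ∧ v 1 = curl (potH pStar) ∧
    (∃ C : ℝ≥0∞, C < ⊤ ∧ ∀ t ∈ Icc (1 : ℝ) τ1, ∫⁻ x, ‖v t x‖ₑ ^ 2 ≤ C)

/-- **STUB B — THE FACES (the mechanism; decided by one 2-D `(r, z)` run; XL).** Every classical finite-energy free run from the
datum on `[1, τ₁]` obeys the cap `(5/3)Y₁ − η` throughout and shows, at `τ₁` inside `‖x‖ ≤ ρ₀`, speed `≥ Y₁ + η`, gradient `≥ A₁ + η`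
and a loop of radius `≤ 1/N₁`, speed `≤ 8π/N₁`, circulation `≥ N₁^{β−2} + η`. Informal content: Hou's tornado growth
(`‖u‖_∞ ∼ (T−t)^{−1/2}`, `‖∇u‖_∞ ∼ (T−t)^{−1}`) persists from this datum at `Re_ℓ ≈ 1.06·10⁴` (`ν_H = 7.3·10⁻³`) down to
`(T−τ₁)/T ≈ 0.03`. Why it might fail: R1 (viscosity threshold, Hou p7 L6 — decided by S0), R2 (`q ≥ 1.12`), R3, R4 of the docstring. -/
def FacesH : Prop :=
  ∀ (v : ℝ → EuclideanSpace ℝ (Fin 3) → EuclideanSpace ℝ (Fin 3)) (q : ℝ → EuclideanSpace ℝ (Fin 3) → ℝ),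
    IsClassicalNSSolutionOn (Icc 1 τ1) 1 0 v q → v 1 = curl (potH pStar) →
    (∃ C : ℝ≥0∞, C < ⊤ ∧ ∀ t ∈ Icc (1 : ℝ) τ1, ∫⁻ x, ‖v t x‖ₑ ^ 2 ≤ C) →
    ∃ η : ℝ, 0 < η ∧
      (∀ t ∈ Icc (1 : ℝ) τ1, ∀ x, ‖v t x‖ ≤ 5 / 3 * TowerRates.tuned.Y 1 - η) ∧
      (∃ x, ‖x‖ ≤ pStar.ρ₀ ∧ TowerRates.tuned.Y 1 + η ≤ ‖v τ1 x‖) ∧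
      (∃ x, ‖x‖ ≤ pStar.ρ₀ ∧ TowerRates.tuned.A 1 + η ≤ ‖fderiv ℝ (v τ1) x‖) ∧
      (∃ (x : EuclideanSpace ℝ (Fin 3)) (γ : ℝ → EuclideanSpace ℝ (Fin 3)),
        ‖x‖ ≤ pStar.ρ₀ ∧ ContDiff ℝ 1 γ ∧ γ 0 = γ 1 ∧
        (∀ s ∈ Icc (0 : ℝ) 1, γ s ∈ closedBall x (1 / TowerRates.tuned.N 1)) ∧
        (∀ s ∈ Icc (0 : ℝ) 1, ‖deriv γ s‖ ≤ 8 * Real.pi / TowerRates.tuned.N 1) ∧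
        TowerRates.tuned.N 1 ^ (TowerRates.tuned.β - 2) + η ≤ circulation (v τ1) γ)

/-- Stub A (static datum lemma). -/
theorem stub_datumStaticH : DatumStaticH := by
  sorry

/-- Stub A′ (anchor at the design point). -/
theorem stub_anchorH : AnchorH := by
  sorry

/-- Stub B0 (the free run stays classical). -/
theorem stub_smoothRunH : SmoothRunH := by
  sorry

/-- Stub B (the faces). -/
theorem stub_facesH : FacesH := by
  sorry

/-- What remains of stub A after §1b: smoothness, axisymmetry and swirl (the support clause is proved). -/
def DatumStaticCoreH : Prop :=
  ∀ p : HouDatum, RegimeH p →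
    ContDiff ℝ ∞ (potH p) ∧ IsAxisymmetric (curl (potH p)) ∧ ¬ HasNoSwirl (curl (potH p))

/-- Stub A follows from its core and the proved support clause (no sorry). -/
theorem datumStaticH_of_core (h : DatumStaticCoreH) : DatumStaticH := fun p hp =>
  ⟨(h p hp).1, potH_tsupport_subset p hp.2.2.1, (h p hp).2.1, (h p hp).2.2⟩

/-- **THE CRUX OF RECORD FROM THE FOUR STUBS (sorry-free composition): static lemma ⊕ anchor ⊕ classical run ⊕ faces ⟹
`EpisodeBaseT` BY NAME**, through the landed binder-form door `Theorems.palasekTowerBreakdown_episodeBaseT_of_mechanism_freeRun`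
at `W := curl (potH pStar)`; static binders discharged by `Germ.contDiff_curl_top`, `Germ.isDivFree_curl`,
`Germ.tsupport_curl_subset`. [cite: Palasek2026ElementaryModel, §4] -/
theorem episodeBaseT_of (hA : DatumStaticH) (hA' : AnchorH) (hB0 : SmoothRunH) (hB : FacesH) :
    PalasekTowerBreakdown.EpisodeBaseT := by
  obtain ⟨v, q, hv, hv1, hE⟩ := hB0
  obtain ⟨η, hη, hcap, hspeed, hstrain, hcore⟩ := hB v q hv hv1 hE
  obtain ⟨hsm, hsupp, -, -⟩ := hA pStar regime_pStar
  exact Theorems.palasekTowerBreakdown_episodeBaseT_of_mechanism_freeRun (Germ.contDiff_curl_top hsm)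
    (Germ.isDivFree_curl hsm) (Germ.tsupport_curl_subset hsupp) hA' regime_pStar.2.2.1.le hv hv1 hE hη hcap hspeed
    hstrain hcore

/-- The crux of record from the four stubs as registered names. -/
theorem episodeBaseT_from_line : PalasekTowerBreakdown.EpisodeBaseT :=
  episodeBaseT_of stub_datumStaticH stub_anchorH stub_smoothRunH stub_facesH

/-! ## §R Rung 2 (no stub, kernel-checked): the same closer at high-Reynolds rates with the tuned per-level ratios -/

/-- **High-Reynolds rates** `hiRe = (2^40, 163/160, 12/5, 49/20)`: `Re₀ = N₀^{β−2} = 2^16`, `(b−1)·log₂N₀ = 3/4` as for `tuned`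
(so `Y₁/Y₀ = 2^{21/20}`, `A₁/A₀ = 2^{9/5}`, `N₀/N₁ = 2^{−3/4}` are unchanged); every `TowerRates` constraint holds by `norm_num`.
[cite: Palasek2026ElementaryModel, §3 (3.2) and Rem. 1.5] -/
def hiRe : TowerRates where
  N₀ := 2 ^ 40
  b := 163 / 160
  β := 12 / 5
  α := 49 / 20
  one_lt_N₀ := by norm_num
  one_lt_b := by norm_num
  two_b_lt_β := by norm_num
  β_lt_α := by norm_num
  two_lt_α := by norm_num
  α_le := by norm_num
  β_lt_one_add_sqrt_two := by
    have h : (7 : ℝ) / 5 < Real.sqrt 2 := by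
      rw [Real.lt_sqrt (by norm_num)]; norm_num
    linarith

/-- The per-level exponent `(b − 1)·log₂ N₀` of `hiRe` equals that of `tuned` (`3/160 · 40 = 1/32 · 24 = 3/4`). [folklore] -/
theorem hiRe_same_step : (hiRe.b - 1) * 40 = (TowerRates.tuned.b - 1) * 24 := by
  norm_num [hiRe, TowerRates.tuned]

/-- `hiRe` keeps the exponents `β, α` of `tuned`. [folklore] -/
theorem hiRe_β_eq : hiRe.β = TowerRates.tuned.β ∧ hiRe.α = TowerRates.tuned.α := by
  refine ⟨?_, ?_⟩ <;> norm_num [hiRe, TowerRates.tuned]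

/-- **The route's `closes` shape at `hiRe`** (the generic closer `navierStokesBreakdownR3_of_heredityGAt`): K1G, heredity at 1 and
from 2 at the high-Reynolds rates decide the same summit conjunct. [cite: FeffermanClay2006, (C)] -/
theorem breakdownR3_of_hiRe (h₁ : EpisodeBaseGAt hiRe) (h₂ : HeredityAtGAt hiRe 1) (h₃ : HeredityFromGAt hiRe 2) :
    Summit.NavierStokesRegularity.NavierStokesRegularity.NavierStokesBreakdownR3 :=
  navierStokesBreakdownR3_of_heredityGAt h₁ h₂ h₃

end Summit.NavierStokesRegularity.NavierStokesRegularity.Cruxes.EpisodeBaseT.HouTornado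

end
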